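import Literature.AlgebraicGeometry.Motives.HodgeThetaAnnihilatorLieAlgebra
import HarnessLib

/-!
# Transfer of tensor annihilation between simultaneously diagonal operators along an implication of letter weights (the word-model form of «a `ℚ`-simple torus has no proper algebraic Lie subalgebra through a rational tensor», Moonen–Zarhin 1999 Lemma (3.6))

Family `hodge`, layer `Literature/AlgebraicGeometry/Motives` (the word model of tensor invariants; no geometry).
Research context: cell `pub-hodge-ring2` (HONEST FRAMING: research route conditional on HC_CM; not a corollary;
Q11.4-sentence-2 already refuted in dim ≥ 3), Literature lane, programme R28b (Moonen–Zarhin 1999 (5.10):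
`S × T`, `S` a simple CM surface) — the supplier of hypothesis (QS) of
`HodgeThetaAnnihilatorRankOneCentreTimesQSimpleTorus`. UNCONDITIONAL linear algebra; theorems only (no
definition, no named fact, D-0026; nothing admitted).

THE POINT. In the tree's word model a complex operator `T` acts on coefficient tensors `c : (Fin d → Fin M) → ℂ`
(words of length `d` in an alphabet `Fin M` = a basis `e` of `W`) by the derivation `D(T)`
(`wordDerAt ℂ (fun _ => toMatrix e e T)`). If `T` is DIAGONAL in another basis `b`, `T bᵢ = δ(i) bᵢ`, then after
the change of letters `e → b` the derivation multiplies the coefficient of a word `w` by its WEIGHT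
`∑ₚ δ(w p)` (`wordDerAt_diagonal_apply`), so «`T` kills `c`» says: the `b`-coefficients of `c` vanish off the
words of weight zero. Hence (MAIN LEMMA `wordDerAt_toMatrix_eq_zero_of_forall_weight`): if `T₁, T₂` are both
diagonal in `b` and EVERY WORD OF `δ₁`-WEIGHT ZERO HAS `δ₂`-WEIGHT ZERO, then whatever `T₁` kills, `T₂` kills.
For the `H¹` of a simple CM surface `S` with CM field `F` (quartic, no imaginary quadratic subfield) and the
operators `y^*`, `y ∈ F⁻ = Lie U_F`, diagonal in the `F`-eigenbasis `(v_σ)_{σ : F → ℂ}` with `δ_y(σ) = σ(y)`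
(and `0` on the letters of the other factor), the weight of a word is `∑_σ n_σ σ(y)` with `n_σ ∈ ℕ` the number of
letters of eigen-type `σ` (`sum_weight_eq_sum_card_mul`), and the implication «weight zero at one non-zero
`y₁ ∈ F⁻` ⟹ weight zero at every `y ∈ F⁻`» is the Galois statement
`NumberTheory/ComplexMultiplication/QuarticCMUnitaryTorusQSimple.sum_mul_apply_eq_zero_of_skew` («`U_F` is a
`ℚ`-simple torus»: a rational character vanishing on a line of `Lie U_F` vanishes on `Lie U_F`). Moonen–Zarhin,
proof of Lemma (3.6): «The assumption that `Hg(X₂)` is `ℚ`-simple implies that `hg(X₂)` does not contain a proper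
algebraic Lie subalgebra.» [held `paper:arxiv-math_9901113` p. 7]

CONTENTS. §1 `wordDerAt_toMatrix_eq_zero_of_forall_weight` (two bases `e`, `b`; transport
`wordDerAt_wordRepAt_eq_zero_of_mul_eq` along `b.toMatrix e` and back along `e.toMatrix b`);
`sum_weight_eq_sum_card_mul` (weights of eigen-typed letters as `∑_σ n_σ σ(y)`); §2 the rational/complex
dictionary `forall_wordDerAt_baseChange_eq_zero_iff` («`X` kills `q`» ⟺ «`X_ℂ` kills `q_ℂ`», `annCondC_baseChange`).

## References

* [MoonenZarhin1999LowDim] B. Moonen, Yu. Zarhin, Math. Ann. 315 (1999), §3 Lemma (3.6) (proof) (held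
  `paper:arxiv-math_9901113` p. 7). [cite: MoonenZarhin1999LowDim, §3 Lemma (3.6)]
* [GoodmanWallachGTM255] R. Goodman, N. R. Wallach, GTM 255 (2009), §4.1.1 (tensor invariants, the word model).
  [cite: GoodmanWallachGTM255, §4.1.1]
* [Deligne1982HodgeCycles] P. Deligne, LNM 900 (1982), I §3 (proof of Prop. 3.4) (rational structures).
  [cite: Deligne1982HodgeCycles, I §3 (proof of Prop. 3.4)]
-/

noncomputable section

open scoped TensorProduct
open Module

namespace Literature.AlgebraicGeometry.Motives

namespace HodgeStructure

open Literature.RepresentationTheory.GeneralLinear Literature.NumberTheory.DiophantineGeometry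

/-! ### §1 Simultaneously diagonal operators: annihilation transfers along an implication of weights -/

section Diagonal

variable {K : Type*} [Field K] {W : Type*} [AddCommGroup W] [Module K W] {M d : ℕ}

/-- The matrix of an operator diagonal in the basis `b` is the diagonal matrix of its eigenvalues.
[cite: GoodmanWallachGTM255, §4.1.1] -/
theorem toMatrix_eq_diagonal_of_apply_basis (b : Module.Basis (Fin M) K W) {T : Module.End K W} {δ : Fin M → K}
    (h : ∀ i, T (b i) = δ i • b i) : LinearMap.toMatrix b b T = Matrix.diagonal δ := by
  classical
  ext i m
  rw [LinearMap.toMatrix_apply, h, map_smul, Module.Basis.repr_self, Finsupp.smul_apply, Finsupp.single_apply,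
    Matrix.diagonal_apply, smul_eq_mul, mul_ite, mul_one, mul_zero]
  by_cases him : i = m
  · subst him; rw [if_pos rfl]
  · rw [if_neg (Ne.symm him), if_neg him]

/-- **Transfer of annihilation along an implication of weights.** Let `T₁`, `T₂` be diagonal in a common basis
`b` of `W`, `T_k bᵢ = δ_k(i) bᵢ`, and suppose every word `w` of `δ₁`-weight `∑ₚ δ₁(w p) = 0` has `δ₂`-weight
`0`. Then every coefficient tensor (in the letters of ANY basis `e`) killed by the derivation of `T₁` is killed
by the derivation of `T₂`: in the letters `b` the derivation of `T_k` multiplies the coefficient of `w` by its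
`δ_k`-weight (`wordDerAt_diagonal_apply`), and the change of letters `e ↔ b` transports annihilators
(`wordDerAt_wordRepAt_eq_zero_of_mul_eq`). («`hg(X₂)` does not contain a proper algebraic Lie subalgebra»
read on one tensor.) [cite: MoonenZarhin1999LowDim, §3 Lemma (3.6)] [cite: GoodmanWallachGTM255, §4.1.1] -/
theorem wordDerAt_toMatrix_eq_zero_of_forall_weight (e b : Module.Basis (Fin M) K W) {T₁ T₂ : Module.End K W}
    {δ₁ δ₂ : Fin M → K} (h₁ : ∀ i, T₁ (b i) = δ₁ i • b i) (h₂ : ∀ i, T₂ (b i) = δ₂ i • b i)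
    (hδ : ∀ w : Word M d, ∑ p, δ₁ (w p) = 0 → ∑ p, δ₂ (w p) = 0) {c : Word M d → K}
    (hc : wordDerAt K (fun _ : Fin d => LinearMap.toMatrix e e T₁) c = 0) :
    wordDerAt K (fun _ : Fin d => LinearMap.toMatrix e e T₂) c = 0 := by
  classical
  set G : Matrix (Fin M) (Fin M) K := e.toMatrix b with hG
  set G' : Matrix (Fin M) (Fin M) K := b.toMatrix e with hG'
  have hGG' : (fun _ : Fin d => G) * (fun _ : Fin d => G') = 1 := by
    funext p
    change G * G' = (1 : Matrix (Fin M) (Fin M) K)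
    rw [hG, hG', Module.Basis.toMatrix_mul_toMatrix_flip]
  -- to the letters `b`: the coefficients of `c' = G'·c` vanish off the words of `δ₁`-weight zero
  have h1' : LinearMap.toMatrix b b T₁ * G' = G' * LinearMap.toMatrix e e T₁ := by
    rw [hG', linearMap_toMatrix_mul_basis_toMatrix, basis_toMatrix_mul_linearMap_toMatrix]
  have hc' : wordDerAt K (fun _ : Fin d => Matrix.diagonal δ₁) (wordRepAt K (fun _ : Fin d => G') c) = 0 := by
    rw [← toMatrix_eq_diagonal_of_apply_basis b h₁]
    exact wordDerAt_wordRepAt_eq_zero_of_mul_eq K (fun _ : Fin d => G') (fun _ => h1') hc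
  have hc'2 : wordDerAt K (fun _ : Fin d => Matrix.diagonal δ₂) (wordRepAt K (fun _ : Fin d => G') c) = 0 := by
    funext w
    have hw := congrFun hc' w
    rw [wordDerAt_diagonal_apply, Pi.zero_apply] at hw ⊢
    rcases mul_eq_zero.1 hw with h0 | h0
    · rw [hδ w h0, zero_mul]
    · rw [h0, mul_zero]
  -- back to the letters `e`
  have h2' : LinearMap.toMatrix e e T₂ * G = G * LinearMap.toMatrix b b T₂ := by
    rw [hG, linearMap_toMatrix_mul_basis_toMatrix, basis_toMatrix_mul_linearMap_toMatrix]
  have h := wordDerAt_wordRepAt_eq_zero_of_mul_eq K (fun _ : Fin d => G) (fun _ => h2')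
    (by rw [toMatrix_eq_diagonal_of_apply_basis b h₂]; exact hc'2)
  rwa [← wordRepAt_mul, hGG', wordRepAt_one] at h

/-- **Weights of eigen-typed letters.** If the letter `i` has eigen-type `τ i : Option E` and weight `δ(i) = χ σ`
for `τ i = some σ`, `δ(i) = 0` for `τ i = none`, then the weight of a word `w` is `∑_σ n_σ(w)·χ(σ)` with
`n_σ(w) = #{p | τ (w p) = some σ}` — a character of the torus evaluated at `χ`. [cite: GoodmanWallachGTM255, §4.1.1] -/
theorem sum_weight_eq_sum_card_mul {E : Type*} [Fintype E] [DecidableEq E] (τ : Fin M → Option E) (χ : E → K)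
    (w : Word M d) :
    ∑ p, Option.elim (τ (w p)) 0 χ =
      ∑ σ, ((Finset.univ.filter fun p => τ (w p) = some σ).card : K) * χ σ := by
  have h : ∀ p, Option.elim (τ (w p)) 0 χ = ∑ σ, if τ (w p) = some σ then χ σ else 0 := by
    intro p
    rcases hτ : τ (w p) with _ | σ₀
    · simp
    · rw [Option.elim_some, Finset.sum_eq_single σ₀]
      · rw [if_pos rfl]
      · intro σ _ hσ
        rw [if_neg (fun h => hσ (Option.some_injective _ h).symm)]
      · intro h
        exact absurd (Finset.mem_univ σ₀) h
  simp_rw [h]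
  rw [Finset.sum_comm]
  refine Finset.sum_congr rfl fun σ _ => ?_
  rw [Finset.sum_ite, Finset.sum_const_zero, add_zero, Finset.sum_const, nsmul_eq_mul]

end Diagonal

/-! ### §2 The rational/complex dictionary for «`X` kills `q`» -/

section Rational

universe u

variable {V : Type u} [AddCommGroup V] [Module ℚ V] {M d m : ℕ}

/-- **«`X` kills `q`» ⟺ «`X_ℂ` kills `q_ℂ`»**: the derivation of the matrix of a RATIONAL operator `X` in the
basis `eQ` kills the slices of a rational coefficient tensor `q` iff the derivation of the matrix of `X_ℂ` in
`1 ⊗ eQ` kills the slices of `q` read in `ℂ` (`annCondC_baseChange`: the complex condition is the image of the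
rational one under `ℚ ↪ ℂ`). [cite: Deligne1982HodgeCycles, I §3 (proof of Prop. 3.4)] [cite: GoodmanWallachGTM255, §4.1.1] -/
theorem forall_wordDerAt_baseChange_eq_zero_iff (eQ : Module.Basis (Fin M) ℚ V) (q : (Fin d → Fin m × Fin M) → ℚ)
    (X : Module.End ℚ V) :
    (∀ u : Fin d → Fin m, wordDerAt ℂ (fun _ : Fin d =>
        LinearMap.toMatrix (Algebra.TensorProduct.basis ℂ eQ) (Algebra.TensorProduct.basis ℂ eQ) (X.baseChange ℂ))
        (wordSlice (fun w => algebraMap ℚ ℂ (q w)) u) = 0) ↔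
      ∀ u : Fin d → Fin m, wordDerAt ℚ (fun _ : Fin d => LinearMap.toMatrix eQ eQ X) (wordSlice q u) = 0 := by
  constructor
  · intro h u
    funext ε
    have hε := congrFun (h u) ε
    rw [← annCondC_apply eQ _ (u, ε), annCondC_baseChange, Pi.zero_apply,
      map_eq_zero_iff _ (algebraMap ℚ ℂ).injective, annCond_apply] at hε
    rw [hε, Pi.zero_apply]
  · intro h u
    funext ε
    have hε := congrFun (h u) ε
    rw [Pi.zero_apply] at hε
    rw [← annCondC_apply eQ _ (u, ε), annCondC_baseChange, annCond_apply, hε, map_zero, Pi.zero_apply]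

end Rational

end HodgeStructure

end Literature.AlgebraicGeometry.Motives

end
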